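import Summits.AtomisticToContinuum.HydrodynamicLimit.Theorems.CollisionIsometryCLTCollisionalTransferLocalityVirialBoundedRung0
import Summits.AtomisticToContinuum.HydrodynamicLimit.Theorems.InformationPercolationEngineCollisionMomentBoundRung0
import Literature.MathematicalPhysics.KineticTheory.CollisionFluxUpperBound
import HarnessLib

/-!
# [TL] at equilibrium: the fast-particle tail of the weighted collision virial is small in probability
(line `hemisphere-affine-slaving`, crux `CollisionalTransferLocality`, stmt-AtomisticToContinuum-9518)

Helper file (`--supports stmt-AtomisticToContinuum-9518`; registered stub `stub_virialTailConst`).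
Under the flow-invariant homogeneous Gibbs law `G_N = localGibbsLaw σ 1 0 θ N Φ_N` (`θ > 0`), for
`0 < σ < σ₀`, every flow family, every `t > 0` and every `δ, ε > 0` there is a velocity level `L₀` such that
for all `L ≥ L₀` and ALL `N`

  `G_N{ δ < T_L(t) } ≤ ε`,
  `T_L(t) = (N+1)⁻¹ Σ_{ordered collisions in (0,t]} 𝟙[‖v_i‖ > L ∨ ‖v_j‖ > L] ε_N ‖Δv_i‖ (1 + ‖v_i‖ + ‖v_j‖)`

(the part of the weighted collision virial `V_N(t)` carried by collisions with a fast post-collisional partner).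

* `collisionPairSum_le_hsDiameter_mul_markSum` — pathwise, on the good set: a kernel dominated by
  `ε_N b(v_i, v_j)` (`b ≥ 0`) has collision pair sum over `(0, t]` at most `ε_N` times the double-sum collision
  functional of the mark `b` over `[0, t]` (contact-pair sums as double sums, `(0,t] ⊆ [0,t]`);
* `localGibbsLaw_lt_collisionPairSum_le` — the resulting MARKOV BOUND at equilibrium, uniform in `N`:
  `G_N{δ < (N+1)⁻¹ Σ g} ≤ (16 t σ³ / δ) · ∫∫ ‖w − v‖ b(v, w) dγ dγ` (`γ = N(0, θ)`), from the
  Cercignani–Illner–Pulvirenti collision-flux bound `localGibbsLaw_collisionMarkSum_ge_le` fed with the swept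
  tube, the minimal-image lift inequality, the Ruelle pair bound at small density (vacuous for `N = 0`) and
  `(N+1) ε_N³ = σ³`;
* `tendsto_lintegral_velTail` — for the tail mark `b_L(v, w) = 3 (1 + ‖v‖² + ‖w‖²) 𝟙[L < ‖v‖ ∨ L < ‖w‖]`
  (which dominates the tail kernel: `virialK ≤ 3 ε_N (1 + ‖v_i‖² + ‖v_j‖²)`, `virialK_le_three_mul`) the
  flux-weighted Gaussian moment `I_L → 0` as `L → ∞` (dominated convergence against `3 ‖w − v‖ (1 + ‖v‖² + ‖w‖²)`,
  finite by `CollisionMomentBound.lintegral_fluxMoment_ne_top`);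
* `stub_virialTailConst` (registered) — `G_N{δ < T_L(t)} ≤ (16 t σ³/δ) I_L ≤ ε` once `I_L ≤ ε δ /(16 t σ³)`.
-/

namespace Summit.AtomisticToContinuum.HydrodynamicLimit.Theorems.HemisphereAffineSlaving

open scoped BigOperators Topology Classical ENNReal InnerProductSpace
open Filter Set Function MeasureTheory
open Literature.Analysis.FluidPDE

noncomputable section

open Literature.MathematicalPhysics.KineticTheory (T3 V3 hsDiameter hsDiameter_pos localGibbsLaw gaussMeasure
  exists_smallDensity uniformProfile SmallDensity posGibbs_pairEvent_le succ_mul_hsDiameter_pow_three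
  localGibbsLaw_collisionMarkSum_ge_le)

/-! ## Collision pair sums dominated by a velocity mark: pathwise and in probability -/

/-- **Pathwise, on the good set.** If a kernel `g` is dominated by `ε_N · b(v_i, v_j)` for a nonnegative mark `b`
of the two (post-collisional) velocities, then its collision pair sum over `(0, t]` is at most `ε_N` times the
double-sum collision functional of `b` over `[0, t]`. -/
theorem collisionPairSum_le_hsDiameter_mul_markSum {σ : ℝ} (hσ : 0 < σ) (Φ : Flows σ) (N : ℕ) (t : ℝ)
    {g : ℝ → Cfg N → Fin (N + 1) → Fin (N + 1) → ℝ} {b : V3 × V3 → ℝ} (hb0 : ∀ p, 0 ≤ b p)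
    (hgb : ∀ s w i j, g s w i j ≤ hsDiameter σ N * b ((w i).2, (w j).2)) {z : Cfg N}
    (hz : z ∈ (Φ N).good) :
    (Φ N).collisionPairSum (Ioc 0 t) g z ≤
      hsDiameter σ N *
        ∑ᶠ s ∈ collisionTimes (Torus.geometry (Fin 3)) (hsDiameter σ N) (fun r => (Φ N).flow r z) ∩ Icc 0 t,
          ∑ i : Fin (N + 1), ∑ j : Fin (N + 1),
            (if i ≠ j ∧ ‖(Torus.geometry (Fin 3)).sepVec ((Φ N).flow s z i).1 ((Φ N).flow s z j).1‖ =
                hsDiameter σ N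
              then b (((Φ N).flow s z i).2, ((Φ N).flow s z j).2) else 0) := by
  have hε : 0 < hsDiameter σ N := hsDiameter_pos hσ N
  have htraj := (Φ N).isTrajectory z hz
  have hfin := htraj.finite_collisionTimes_inter_Ioc 0 t
  have hfin' : (collisionTimes (Torus.geometry (Fin 3)) (hsDiameter σ N) (fun r => (Φ N).flow r z) ∩
      Icc 0 t).Finite := htraj.locFinite 0 t
  -- termwise bound at one collision time, contact-pair sum as a double sum
  have hterm : ∀ s, ∑ p ∈ contactPairs (Torus.geometry (Fin 3)) (hsDiameter σ N) ((Φ N).flow s z),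
      g s ((Φ N).flow s z) p.1 p.2 ≤
      hsDiameter σ N * ∑ i : Fin (N + 1), ∑ j : Fin (N + 1),
        (if i ≠ j ∧ ‖(Torus.geometry (Fin 3)).sepVec ((Φ N).flow s z i).1 ((Φ N).flow s z j).1‖ =
            hsDiameter σ N
          then b (((Φ N).flow s z i).2, ((Φ N).flow s z j).2) else 0) := by
    intro s
    refine (Finset.sum_le_sum fun p _ => hgb s ((Φ N).flow s z) p.1 p.2).trans (le_of_eq ?_)
    rw [sum_contactPairs_eq (htraj.mem s) (fun i j =>
      hsDiameter σ N * b (((Φ N).flow s z i).2, ((Φ N).flow s z j).2))]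
    simp only [Finset.mul_sum, mul_ite, mul_zero]
  unfold HardSphereFlow.collisionPairSum
  rw [collisionPairSum_eq_finset_sum hfin, finsum_mem_eq_finite_toFinset_sum _ hfin', Finset.mul_sum]
  refine (Finset.sum_le_sum fun s _ => hterm s).trans ?_
  refine Finset.sum_le_sum_of_subset_of_nonneg ?_ fun s _ _ => ?_
  · intro s hs
    rw [Set.Finite.mem_toFinset] at hs ⊢
    exact ⟨hs.1, hs.2.1.le, hs.2.2⟩
  · refine mul_nonneg hε.le (Finset.sum_nonneg fun i _ => Finset.sum_nonneg fun j _ => ?_)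
    split_ifs
    · exact hb0 _
    · exact le_rfl

/-- **Markov bound at equilibrium, uniform in `N`.** Under the homogeneous Gibbs law `G_N = localGibbsLaw σ 1 0 θ N Φ_N`
at small reduced density, a kernel `g` dominated by `ε_N · b(v_i, v_j)` (`b ≥ 0` measurable) satisfies, for every
`N`, `t > 0`, `δ > 0`,
`G_N{δ < (N+1)⁻¹ Σ_{collisions in (0,t]} g} ≤ (16 t σ³ / δ) · ∫∫ ‖w − v‖ b(v, w) dγ(v) dγ(w)`, `γ = N(0, θ)` —
the Cercignani–Illner–Pulvirenti collision-flux bound in Markov form (`localGibbsLaw_collisionMarkSum_ge_le`)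
and `(N+1) ε_N³ = σ³`. -/
theorem localGibbsLaw_lt_collisionPairSum_le {θ : ℝ} (hθ : 0 < θ) {σ : ℝ} (hsm : SmallDensity uniformProfile σ)
    (Φ : Flows σ) (N : ℕ) {t : ℝ} (ht : 0 < t) {g : ℝ → Cfg N → Fin (N + 1) → Fin (N + 1) → ℝ}
    {b : V3 × V3 → ℝ} (hbm : Measurable b) (hb0 : ∀ p, 0 ≤ b p)
    (hgb : ∀ s w i j, g s w i j ≤ hsDiameter σ N * b ((w i).2, (w j).2)) {δ : ℝ} (hδ : 0 < δ) :
    localGibbsLaw σ (fun _ => 1) (fun _ => 0) (fun _ => θ) N (Φ N)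
        {z | δ < ((N : ℝ) + 1)⁻¹ * (Φ N).collisionPairSum (Ioc 0 t) g z} ≤
      ENNReal.ofReal (16 * t * σ ^ 3 / δ) *
        ∫⁻ p, ENNReal.ofReal (‖p.2 - p.1‖ * b p) ∂((gaussMeasure (0 : V3) θ).prod (gaussMeasure (0 : V3) θ)) := by
  have hσ : 0 < σ := hsm.σ_pos
  have hε' : 0 < hsDiameter σ N := hsDiameter_pos hσ N
  have hMu0 : 0 < hsDiameter σ N / ((N : ℝ) + 1) := by positivity
  have hη'0 : 0 < δ / (hsDiameter σ N / ((N : ℝ) + 1)) := div_pos hδ hMu0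
  -- the Markov-form collision-flux bound for the mark `b`
  have hBle := localGibbsLaw_collisionMarkSum_ge_le hsm.σ_lt_half.le one_pos hθ (0 : V3) (Φ N)
    (measurePreserving_flow_localGibbsLaw_const σ 1 θ 0 N (Φ N))
    (fun i j hij T hT => by
      rcases Nat.eq_zero_or_pos N with hN0 | hN
      · exact absurd (Fin.ext (by have := i.isLt; have := j.isLt; omega)) hij
      · exact posGibbs_pairEvent_le hsm hN hij hT)
    (fun h hh => exists_sweptTube (hsDiameter_pos hσ N) hh)
    (fun S hS => by simpa only [sub_zero] using volume_setOf_exists_reprSym_add_latticeVec_mem_le 0 hS)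
    ht hbm hb0 hη'0
  -- pathwise: on the good set `(N+1)⁻¹ Σ g ≤ (ε_N/(N+1)) · S_b`
  have hsub : {z : Cfg N | δ < ((N : ℝ) + 1)⁻¹ * (Φ N).collisionPairSum (Ioc 0 t) g z} ⊆
      (Φ N).goodᶜ ∪ {z | z ∈ (Φ N).good ∧ δ / (hsDiameter σ N / ((N : ℝ) + 1)) ≤
        ∑ᶠ s ∈ collisionTimes (Torus.geometry (Fin 3)) (hsDiameter σ N) (fun r => (Φ N).flow r z) ∩ Icc 0 t,
          ∑ i : Fin (N + 1), ∑ j : Fin (N + 1),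
            (if i ≠ j ∧ ‖(Torus.geometry (Fin 3)).sepVec ((Φ N).flow s z i).1 ((Φ N).flow s z j).1‖ =
                hsDiameter σ N
              then b (((Φ N).flow s z i).2, ((Φ N).flow s z j).2) else 0)} := by
    intro z hz
    by_cases hgood : z ∈ (Φ N).good
    · refine Or.inr ⟨hgood, ?_⟩
      rw [div_le_iff₀' hMu0]
      refine (le_of_lt hz).trans ?_
      rw [div_eq_mul_inv, mul_comm (hsDiameter σ N), mul_assoc]
      exact mul_le_mul_of_nonneg_left
        (collisionPairSum_le_hsDiameter_mul_markSum hσ Φ N t hb0 hgb hgood) (by positivity)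
    · exact Or.inl hgood
  have hgood0 : localGibbsLaw σ (fun _ => 1) (fun _ => 0) (fun _ => θ) N (Φ N) (Φ N).goodᶜ = 0 :=
    localGibbsLaw_compl_good' (Φ N)
  -- the arithmetic of the constants: `(ε_N/(N+1))/δ · 16 t (N+1)² ε_N² = 16 t σ³ / δ`
  have hε3 : ((N + 1 : ℕ) : ℝ) * hsDiameter σ N ^ 3 = σ ^ 3 := succ_mul_hsDiameter_pow_three σ N
  have hconst : (δ / (hsDiameter σ N / ((N : ℝ) + 1)))⁻¹ *
      (16 * t * ((N + 1 : ℕ) : ℝ) ^ 2 * hsDiameter σ N ^ 2) = 16 * t * σ ^ 3 / δ := by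
    rw [← hε3]
    push_cast
    field_simp
  calc localGibbsLaw σ (fun _ => 1) (fun _ => 0) (fun _ => θ) N (Φ N) _
      ≤ localGibbsLaw σ (fun _ => 1) (fun _ => 0) (fun _ => θ) N (Φ N) ((Φ N).goodᶜ ∪ _) := measure_mono hsub
    _ ≤ localGibbsLaw σ (fun _ => 1) (fun _ => 0) (fun _ => θ) N (Φ N) (Φ N).goodᶜ +
        localGibbsLaw σ (fun _ => 1) (fun _ => 0) (fun _ => θ) N (Φ N) _ := measure_union_le _ _
    _ ≤ 0 + (ENNReal.ofReal (δ / (hsDiameter σ N / ((N : ℝ) + 1))))⁻¹ *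
        (ENNReal.ofReal (16 * t * ((N + 1 : ℕ) : ℝ) ^ 2 * hsDiameter σ N ^ 2) *
          ∫⁻ p, ENNReal.ofReal (‖p.2 - p.1‖ * b p) ∂((gaussMeasure (0 : V3) θ).prod (gaussMeasure (0 : V3) θ))) := by
        rw [hgood0]
        exact add_le_add le_rfl hBle
    _ = _ := by
        rw [zero_add, ← mul_assoc, ← ENNReal.ofReal_inv_of_pos hη'0, ← ENNReal.ofReal_mul (by positivity),
          hconst]

/-! ## The velocity-tail mark -/

/-- The tail mark `b_L(v, w) = 3 (1 + ‖v‖² + ‖w‖²) 𝟙[L < ‖v‖ ∨ L < ‖w‖]` is nonnegative. -/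
theorem velTail_nonneg (L : ℝ) (p : V3 × V3) :
    0 ≤ (if L < ‖p.1‖ ∨ L < ‖p.2‖ then 3 * (1 + ‖p.1‖ ^ 2 + ‖p.2‖ ^ 2) else (0 : ℝ)) := by
  split_ifs <;> positivity

/-- The tail mark is measurable. -/
theorem measurable_velTail (L : ℝ) :
    Measurable fun p : V3 × V3 => (if L < ‖p.1‖ ∨ L < ‖p.2‖ then 3 * (1 + ‖p.1‖ ^ 2 + ‖p.2‖ ^ 2) else (0 : ℝ)) := by
  refine Measurable.ite ?_ (by fun_prop) measurable_const
  exact (measurableSet_lt measurable_const measurable_fst.norm).union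
    (measurableSet_lt measurable_const measurable_snd.norm)

/-- Termwise: the tail kernel is at most `ε_N · b_L(v_i, v_j)` (`virialK ≤ 3 ε_N (1 + ‖v_i‖² + ‖v_j‖²)`). -/
theorem tailVirialK_le {σ : ℝ} (hσ : 0 < σ) (N : ℕ) (L s : ℝ) (w : Cfg N) (i j : Fin (N + 1)) :
    (if L < ‖(w i).2‖ ∨ L < ‖(w j).2‖ then virialK σ N s w i j else 0) ≤
      hsDiameter σ N *
        (if L < ‖(w i).2‖ ∨ L < ‖(w j).2‖ then 3 * (1 + ‖(w i).2‖ ^ 2 + ‖(w j).2‖ ^ 2) else (0 : ℝ)) := by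
  split_ifs
  · exact virialK_le_three_mul hσ N s w i j
  · rw [mul_zero]

/-- **The flux-weighted Gaussian tail moment vanishes**: `I_L = ∫ ‖w − v‖ · b_L(v, w) dγ(v) dγ(w) → 0` as `L → ∞`
(`γ = N(0, θ)`), by dominated convergence against `3 ‖w − v‖ (1 + ‖v‖² + ‖w‖²)`. -/
theorem tendsto_lintegral_velTail (θ : ℝ) :
    Tendsto (fun L : ℝ => ∫⁻ p, ENNReal.ofReal (‖p.2 - p.1‖ *
        (if L < ‖p.1‖ ∨ L < ‖p.2‖ then 3 * (1 + ‖p.1‖ ^ 2 + ‖p.2‖ ^ 2) else (0 : ℝ)))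
      ∂((gaussMeasure (0 : V3) θ).prod (gaussMeasure (0 : V3) θ))) atTop (𝓝 0) := by
  have h0 : (0 : ℝ≥0∞) = ∫⁻ _ : V3 × V3, 0 ∂((gaussMeasure (0 : V3) θ).prod (gaussMeasure (0 : V3) θ)) :=
    lintegral_zero.symm
  rw [h0]
  refine tendsto_lintegral_filter_of_dominated_convergence
    (fun p => ENNReal.ofReal 3 * ENNReal.ofReal (‖p.2 - p.1‖ * (1 + ‖p.1‖ ^ 2 + ‖p.2‖ ^ 2))) ?_ ?_ ?_ ?_
  · exact Eventually.of_forall fun L =>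
      ((measurable_snd.sub measurable_fst).norm.mul (measurable_velTail L)).ennreal_ofReal
  · refine Eventually.of_forall fun L => ae_of_all _ fun p => ?_
    rw [← ENNReal.ofReal_mul (by norm_num)]
    refine ENNReal.ofReal_le_ofReal ?_
    have hle : (if L < ‖p.1‖ ∨ L < ‖p.2‖ then 3 * (1 + ‖p.1‖ ^ 2 + ‖p.2‖ ^ 2) else (0 : ℝ)) ≤
        3 * (1 + ‖p.1‖ ^ 2 + ‖p.2‖ ^ 2) := by
      split_ifs
      · exact le_rfl
      · positivity
    calc ‖p.2 - p.1‖ * (if L < ‖p.1‖ ∨ L < ‖p.2‖ then 3 * (1 + ‖p.1‖ ^ 2 + ‖p.2‖ ^ 2) else (0 : ℝ))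
        ≤ ‖p.2 - p.1‖ * (3 * (1 + ‖p.1‖ ^ 2 + ‖p.2‖ ^ 2)) := mul_le_mul_of_nonneg_left hle (norm_nonneg _)
      _ = 3 * (‖p.2 - p.1‖ * (1 + ‖p.1‖ ^ 2 + ‖p.2‖ ^ 2)) := by ring
  · rw [lintegral_const_mul' _ _ ENNReal.ofReal_ne_top]
    exact ENNReal.mul_ne_top ENNReal.ofReal_ne_top (CollisionMomentBound.lintegral_fluxMoment_ne_top 0 θ)
  · refine ae_of_all _ fun p => ?_
    refine tendsto_const_nhds.congr' ?_
    filter_upwards [eventually_ge_atTop (max ‖p.1‖ ‖p.2‖)] with L hL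
    rw [if_neg (not_or.2 ⟨not_lt.2 (le_of_max_le_left hL), not_lt.2 (le_of_max_le_right hL)⟩), mul_zero,
      ENNReal.ofReal_zero]

/-! ## The registered stub -/

/-- **[TL] AT EQUILIBRIUM.** Under the flow-invariant homogeneous Gibbs law `G_N = localGibbsLaw σ 1 0 θ N Φ_N`
(`θ > 0`) there is `σ₀ > 0` such that for `0 < σ < σ₀`, every flow family, every `t > 0` and all `δ, ε > 0`
there is `L₀` with `G_N{δ < T_L(t)} ≤ ε` for all `L ≥ L₀` and ALL `N`, where `T_L(t)` is the part of the
weighted collision virial over `(0, t]` carried by collisions with a fast (`‖v‖ > L`) post-collisional partner —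
the uniform-in-`N` Markov bound `localGibbsLaw_lt_collisionPairSum_le` for the tail mark
(`G_N{δ < T_L(t)} ≤ (16 t σ³/δ) I_L`) and `I_L → 0` (`tendsto_lintegral_velTail`). -/
theorem stub_virialTailConst : ∀ θ : ℝ, 0 < θ → ∃ σ₀ : ℝ, 0 < σ₀ ∧ ∀ σ : ℝ, 0 < σ → σ < σ₀ → ∀ (Φ : Flows σ) (t : ℝ), 0 < t → ∀ δ ε : ℝ, 0 < δ → 0 < ε → ∃ L₀ : ℝ, ∀ L : ℝ, L₀ ≤ L → ∀ N : ℕ, Literature.MathematicalPhysics.KineticTheory.localGibbsLaw σ (fun _ => 1) (fun _ => 0) (fun _ => θ) N (Φ N) {z | δ < ((N : ℝ) + 1)⁻¹ * (Φ N).collisionPairSum (Ioc 0 t) (fun s w i j => if L < ‖(w i).2‖ ∨ L < ‖(w j).2‖ then virialK σ N s w i j else 0) z} ≤ ENNReal.ofReal ε := by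
  intro θ hθ
  obtain ⟨σ₀, hσ₀, hsmall⟩ := exists_smallDensity uniformProfile one_pos
  refine ⟨σ₀, hσ₀, fun σ hσ hσlt Φ t ht δ ε hδ hε => ?_⟩
  have hsm : SmallDensity uniformProfile σ := (hsmall σ hσ hσlt).1
  -- the threshold on the tail moment and the level `L₀`
  have hc0 : 0 < ε * δ / (16 * t * σ ^ 3) := by positivity
  obtain ⟨L₀, hL₀⟩ := eventually_atTop.1
    ((tendsto_lintegral_velTail θ).eventually_lt_const (ENNReal.ofReal_pos.2 hc0))
  refine ⟨L₀, fun L hL N => ?_⟩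
  refine (localGibbsLaw_lt_collisionPairSum_le hθ hsm Φ N ht (measurable_velTail L) (velTail_nonneg L)
    (fun s w i j => tailVirialK_le hσ N L s w i j) hδ).trans ?_
  refine (mul_le_mul_of_nonneg_left (hL₀ L hL).le zero_le).trans_eq ?_
  rw [← ENNReal.ofReal_mul (by positivity)]
  congr 1
  have h16 : 16 * t * σ ^ 3 ≠ 0 := by positivity
  calc 16 * t * σ ^ 3 / δ * (ε * δ / (16 * t * σ ^ 3)) = ε * (δ / δ) * (16 * t * σ ^ 3 / (16 * t * σ ^ 3)) := by
        ring
    _ = ε := by rw [div_self hδ.ne', div_self h16, mul_one, mul_one]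

end

end Summit.AtomisticToContinuum.HydrodynamicLimit.Theorems.HemisphereAffineSlaving
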